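import Summits.HodgeConjecture.CorCM.Model.DiagonalDegree
import Summits.HodgeConjecture.CorCM.RationalExteriorAlgebra
import HarnessLib

/-!
# COR-CM model layer (row M22 `Fact_algDuality`, clause (ii), the case `a = 0`): a morphism into an abelian
# variety that kills `H¹` kills every positive degree

Cell `pub-hodgecm2` (COR-CM), seat `b14` (reserve piece `(ii)₀`).  Clause (ii) of the stage-1 fact `Fact_algDuality`
(`CorCM/Geometry/Facts.lean`) asks, for EVERY `a ∈ K` and all `Ma`, `Mb : P → P` acting diagonally by `a`, `ā`
(`IsDiagAct`), that `Mb^* ∘ D ∘ Ma^* = N_{K/ℚ}(a)⁴ • D` on `H^{2(d-2)}(P; ℚ)`.  For `a ≠ 0` this is the intertwining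
identity of `CorCM/Model/FourierIntertwine.lean` (seat b22), which needs `Ma^*|_{H¹} = ⊕ᵢ ιᵢ(a)` to be INVERTIBLE.
For `a = 0` that route is closed (`Ma^* = 0` on `H¹`), but the statement holds for another reason: `N(0)⁴ = 0`, and
`Ma^*` vanishes on every `Hᵐ(P; ℚ)`, `m ≥ 1`, because `H•(P; ℚ)` is generated in degree one.  THIS FILE proves
exactly that, def-free, on the model's carriers:

* `pull_eq_zero_of_pull_one_eq_zero` — for an abelian variety `A/ℂ` and any `ℂ`-morphism `f : Y ⟶ A.X` with
  `f^* = 0` on `H¹(A(ℂ); ℚ)`: `f^* = 0` on `Hᵐ(A(ℂ); ℚ)` for every `m ≥ 1` (`Hᵐ = ⋀ᵐ H¹`, the cell's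
  `hasExteriorCohomologyH1_rat` with `range_wedgeToCup`; `f^*` is multiplicative on the iterated products,
  `map_cupPowOne`);
* `pull_one_eq_zero_of_comp_pr4_eq_zero` — on the left-nested product `((X₀ ⊗ X₁) ⊗ X₂) ⊗ X₃` of smooth
  projective varieties, an `M^*` on `H¹` that vanishes after each of the four pull-backs `prᵢ^*` vanishes
  (Künneth in degree one, model-1's `kunneth_one_bijective₄`, spelling of the package's `pr4`);
* `pull_eq_zero_of_isDiagAct_zero` — the two combined in the binder block of model-1's `var_deg_diag` at `a = 0`
  (intertwinings `M^* ∘ prᵢ^* = prᵢ^* ∘ dᵢ^*` on `H¹` with `dᵢ^* = ι(0) = 0`): `M^* = 0` on `Hᵐ`, `m ≥ 1`, for the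
  corner product of four coded CM abelian varieties;
* `comp_comp_pull_eq_norm_zero_pow_smul` — the literal clause-(ii) shape at `a = 0`:
  `g ∘ₗ D ∘ₗ M^* = (Algebra.norm ℚ (0 : K))⁴ • D` for ANY `ℚ`-linear `D`, `g` once `M^* = 0` (`Algebra.norm_zero`).

Print shape: Mumford, *Abelian Varieties* §1 (4) (`H•(A; ℚ) = ⋀• H¹(A; ℚ)`); Voisin I Thm. 11.38 (Künneth).
Entirely a theorem of the tree; explicit binders; no definitions.
-/

noncomputable section

open CategoryTheory MonoidalCategory CartesianMonoidalCategory
open Literature.AlgebraicTopology.SingularHomology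
open Literature.AlgebraicGeometry.Motives (SchemeOver ComplexPoints IsSmoothProjective bettiCohomology AbelianVariety)
open Literature.AlgebraicGeometry.HodgeTheory
open Literature.NumberTheory.Automorphic.PicardCM

namespace Summit.HodgeConjecture.CorCM.Model

/-! ### A morphism into an abelian variety that kills `H¹` kills all positive degrees -/

section AbelianVariety

/-- **`f^*|_{H¹} = 0 ⟹ f^*|_{Hᵐ} = 0` for `m ≥ 1`**, for any `ℂ`-morphism `f : Y ⟶ A.X` into (the scheme of) a
complex abelian variety `A`: `Hᵐ(A(ℂ); ℚ)` is spanned by the iterated cup products `m_m(v₀, …, v_{m-1})` of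
degree-one classes (`⋀ᵐ H¹ ≅ Hᵐ`, `hasExteriorCohomologyH1_rat`, `range_wedgeToCup`), and
`f^* m_m(v) = m_m(f^* ∘ v) = m_m(0, …) = 0` (`map_cupPowOne`, multilinearity). [cite: MumfordAV1970, §1 (4)] -/
theorem pull_eq_zero_of_pull_one_eq_zero (A : AbelianVariety ℂ) {Y : SchemeOver ℂ} (f : Y ⟶ A.X)
    (h1 : BettiUniverse.pull f 1 = 0) {m : ℕ} (hm : 1 ≤ m) : BettiUniverse.pull f m = 0 := by
  -- the words span `Hᵐ(A(ℂ); ℚ)`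
  have hspan : Submodule.span ℚ (Set.range (cupPowOne ℚ (ComplexPoints A.X) m)) = ⊤ := by
    rw [← range_wedgeToCup, LinearMap.range_eq_top]
    exact (hasExteriorCohomologyH1_rat A m).2
  refine LinearMap.ext fun x ↦ ?_
  have hx : x ∈ Submodule.span ℚ (Set.range (cupPowOne ℚ (ComplexPoints A.X) m)) := by
    rw [hspan]; exact Submodule.mem_top
  rw [LinearMap.zero_apply]
  refine Submodule.span_induction ?_ (map_zero _) (fun a b _ _ ha hb ↦ by rw [map_add, ha, hb, add_zero])
    (fun c a _ ha ↦ by rw [map_smul, ha, smul_zero]) hx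
  rintro _ ⟨v, rfl⟩
  change singularCohomology.map ℚ ℚ (Literature.AlgebraicGeometry.Motives.AlgPoints.mapContinuous (L := ℂ) f) m
    (cupPowOne ℚ (ComplexPoints A.X) m v) = 0
  rw [map_cupPowOne]
  obtain ⟨m, rfl⟩ : ∃ m', m = m' + 1 := ⟨m - 1, by omega⟩
  refine MultilinearMap.map_coord_zero _ (0 : Fin (m + 1)) ?_
  change BettiUniverse.pull f 1 (v 0) = 0
  rw [h1, LinearMap.zero_apply]

end AbelianVariety

/-! ### Künneth in degree one, vanishing form, for the left-nested fourfold product -/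

section Kunneth

variable {n₀ n₁ n₂ n₃ : ℕ} {X₀ X₁ X₂ X₃ Y : SchemeOver ℂ}

/-- **If `M^* ∘ prᵢ^* = 0` on `H¹` for the four projections of `((X₀ ⊗ X₁) ⊗ X₂) ⊗ X₃`, then `M^* = 0` on
`H¹`** (the four pull-backs `prᵢ^*` are jointly surjective onto `H¹` of the product: Künneth in degree one,
`kunneth_one_bijective₄`; projections spelled as the package's `pr4`). [cite: VoisinHodgeI2002, Thm. 11.38] -/
theorem pull_one_eq_zero_of_comp_pr4_eq_zero (h₀ : IsSmoothProjective n₀ X₀) (h₁ : IsSmoothProjective n₁ X₁)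
    (h₂ : IsSmoothProjective n₂ X₂) (h₃ : IsSmoothProjective n₃ X₃) (M : Y ⟶ ((X₀ ⊗ X₁) ⊗ X₂) ⊗ X₃)
    (hM₀ : BettiUniverse.pull M 1 ∘ₗ
      BettiUniverse.pull (fst ((X₀ ⊗ X₁) ⊗ X₂) X₃ ≫ (fst (X₀ ⊗ X₁) X₂ ≫ fst X₀ X₁)) 1 = 0)
    (hM₁ : BettiUniverse.pull M 1 ∘ₗ
      BettiUniverse.pull (fst ((X₀ ⊗ X₁) ⊗ X₂) X₃ ≫ (fst (X₀ ⊗ X₁) X₂ ≫ snd X₀ X₁)) 1 = 0)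
    (hM₂ : BettiUniverse.pull M 1 ∘ₗ BettiUniverse.pull (fst ((X₀ ⊗ X₁) ⊗ X₂) X₃ ≫ snd (X₀ ⊗ X₁) X₂) 1 = 0)
    (hM₃ : BettiUniverse.pull M 1 ∘ₗ BettiUniverse.pull (snd ((X₀ ⊗ X₁) ⊗ X₂) X₃) 1 = 0) :
    BettiUniverse.pull M 1 = 0 := by
  have hK := kunneth_one_bijective₄ h₀ h₁ h₂ h₃
  refine LinearMap.ext fun x ↦ ?_
  obtain ⟨⟨⟨⟨a, b⟩, c⟩, d⟩, rfl⟩ := hK.2 x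
  have e₀ := LinearMap.congr_fun hM₀ a
  have e₁ := LinearMap.congr_fun hM₁ b
  have e₂ := LinearMap.congr_fun hM₂ c
  have e₃ := LinearMap.congr_fun hM₃ d
  simp only [LinearMap.comp_apply, LinearMap.zero_apply] at e₀ e₁ e₂ e₃
  simp only [LinearMap.coprod_apply, map_add, LinearMap.zero_apply, e₀, e₁, e₂, e₃, add_zero]

end Kunneth

/-! ### The corner product of four coded CM abelian varieties: the diagonal action by `a = 0` -/

section Corner

/-- **Clause (ii) of `Fact_algDuality` at `a = 0`, cohomological half**: in the binder block of model-1's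
`var_deg_diag` (corner product `P` of four coded CM abelian varieties, a self-map `M` of `P` intertwined on `H¹`,
through the four projections, with self-maps `dᵢ` of the factors), if the `dᵢ` act on `H¹` by `ι(0)` (`= 0`) —
this is `IsDiagAct K Φ 0 M` of the model universe, unfolded — then `M^* = 0` on `Hᵐ(P(ℂ); ℚ)` for every `m ≥ 1`
(`pull_one_eq_zero_of_comp_pr4_eq_zero`, then `pull_eq_zero_of_pull_one_eq_zero` for the product abelian
variety, whose scheme is `P` definitionally). [cite: MumfordAV1970, §1 (4)] -/
theorem pull_eq_zero_of_isDiagAct_zero (hHD : exists_isReal_hodgeModel) (hI : hodgePQ_independent_of_hodgeModel)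
    (hU : BallQuotientUniformisedDatum) (h₃ : CMAbelianVarietyRealised) (c : Fin 4 → CMCode) {K : Type} [Field K]
    [NumberField K] (e : (i : Fin 4) → (K ≃+* (c i).E))
    (M : Var.Mor hU h₃ (Var.prod (Var.prod (Var.prod (.cm (c 0)) (.cm (c 1))) (.cm (c 2))) (.cm (c 3)))
      (Var.prod (Var.prod (Var.prod (.cm (c 0)) (.cm (c 1))) (.cm (c 2))) (.cm (c 3))))
    (d : (i : Fin 4) → Var.Mor hU h₃ (.cm (c i)) (.cm (c i)))
    (hd : ∀ i, BettiUniverse.pull (d i) 1 =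
      (BettiUniverse.cmEndAction ((cmRealisation h₃ (c i)).θ.comp (e i).toRingHom)
        ((cmRealisation h₃ (c i)).exists_map_comp (e i)) hHD hI (Var.isSmoothProjective hU h₃ (.cm (c i)))).ι 0)
    (hM₀ : BettiUniverse.pull M 1 ∘ₗ
        BettiUniverse.pull (Var.comp hU h₃ (Var.fst hU h₃ _ (.cm (c 3)))
          (Var.comp hU h₃ (Var.fst hU h₃ _ (.cm (c 2))) (Var.fst hU h₃ (.cm (c 0)) (.cm (c 1))))) 1 =
      BettiUniverse.pull (Var.comp hU h₃ (Var.fst hU h₃ _ (.cm (c 3)))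
          (Var.comp hU h₃ (Var.fst hU h₃ _ (.cm (c 2))) (Var.fst hU h₃ (.cm (c 0)) (.cm (c 1))))) 1 ∘ₗ
        BettiUniverse.pull (d 0) 1)
    (hM₁ : BettiUniverse.pull M 1 ∘ₗ
        BettiUniverse.pull (Var.comp hU h₃ (Var.fst hU h₃ _ (.cm (c 3)))
          (Var.comp hU h₃ (Var.fst hU h₃ _ (.cm (c 2))) (Var.snd hU h₃ (.cm (c 0)) (.cm (c 1))))) 1 =
      BettiUniverse.pull (Var.comp hU h₃ (Var.fst hU h₃ _ (.cm (c 3)))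
          (Var.comp hU h₃ (Var.fst hU h₃ _ (.cm (c 2))) (Var.snd hU h₃ (.cm (c 0)) (.cm (c 1))))) 1 ∘ₗ
        BettiUniverse.pull (d 1) 1)
    (hM₂ : BettiUniverse.pull M 1 ∘ₗ
        BettiUniverse.pull (Var.comp hU h₃ (Var.fst hU h₃ _ (.cm (c 3))) (Var.snd hU h₃ _ (.cm (c 2)))) 1 =
      BettiUniverse.pull (Var.comp hU h₃ (Var.fst hU h₃ _ (.cm (c 3))) (Var.snd hU h₃ _ (.cm (c 2)))) 1 ∘ₗ
        BettiUniverse.pull (d 2) 1)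
    (hM₃ : BettiUniverse.pull M 1 ∘ₗ BettiUniverse.pull (Var.snd hU h₃ _ (.cm (c 3))) 1 =
      BettiUniverse.pull (Var.snd hU h₃ _ (.cm (c 3))) 1 ∘ₗ BettiUniverse.pull (d 3) 1)
    {m : ℕ} (hm : 1 ≤ m) : BettiUniverse.pull M m = 0 := by
  have hd0 : ∀ i, BettiUniverse.pull (d i) 1 = 0 := fun i ↦ by rw [hd i, map_zero]; rfl
  rw [hd0, LinearMap.comp_zero] at hM₀ hM₁ hM₂ hM₃
  have h1 : BettiUniverse.pull M 1 = 0 :=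
    pull_one_eq_zero_of_comp_pr4_eq_zero (Var.isSmoothProjective hU h₃ (.cm (c 0)))
      (Var.isSmoothProjective hU h₃ (.cm (c 1))) (Var.isSmoothProjective hU h₃ (.cm (c 2)))
      (Var.isSmoothProjective hU h₃ (.cm (c 3))) M hM₀ hM₁ hM₂ hM₃
  -- the corner product is the scheme of the product abelian variety
  exact pull_eq_zero_of_pull_one_eq_zero
    ((((cmRealisation h₃ (c 0)).AV.prod (cmRealisation h₃ (c 1)).AV).prod (cmRealisation h₃ (c 2)).AV).prod
      (cmRealisation h₃ (c 3)).AV) M h1 hm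

/-- **Clause (ii) of `Fact_algDuality` at `a = 0`, literal shape**: once `M^* = 0` on the source degree,
`g ∘ₗ D ∘ₗ M^* = (Algebra.norm ℚ (0 : K))⁴ • D` for ANY `ℚ`-linear `D` out of that degree and any `g` on its target
(`Algebra.norm ℚ (0 : K) = 0` for a number field `K`, `Algebra.norm_zero`). [folklore] -/
theorem comp_comp_pull_eq_norm_zero_pow_smul (K : Type) [Field K] [NumberField K] {X : SchemeOver ℂ} (M : X ⟶ X)
    {m : ℕ} (hM : BettiUniverse.pull M m = 0) {V : Type} [AddCommGroup V] [Module ℚ V]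
    (D : bettiCohomology X m →ₗ[ℚ] V) (g : V →ₗ[ℚ] V) :
    g ∘ₗ D ∘ₗ BettiUniverse.pull M m = ((Algebra.norm ℚ (0 : K)) ^ 4) • D := by
  rw [hM, LinearMap.comp_zero, LinearMap.comp_zero, Algebra.norm_zero, zero_pow four_ne_zero, zero_smul]

end Corner

end Summit.HodgeConjecture.CorCM.Model

end
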